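import Summits.Ventures.DiscreteObjects.Hadamard.Order334Orbits
import Summits.Ventures.DiscreteObjects.Hadamard.HadamardOrder4q

/-!
# Hadamard matrices of order 4q (q ≥ 5 prime): an automorphism of order 2q is semiregular — two row orbits and two column orbits of length 2q (kernel)

Framing: lottery ticket; floor = certified bounds/negative ranges.

Cell pub-namedobj (venture DiscreteObjects), target (H), hadamard gen 12.  Uniform version of `Order334Orbits` (the case `q = 167`):
let `H` be a Hadamard matrix of order `4q`, `q ≥ 5` prime, and `(π, κ, d, e)` a signed-permutation automorphism with
`π^(2q) = κ^(2q) = 1`, `(π², κ²) ≠ (1,1)`, `(π^q, κ^q) ≠ (1,1)` (the permutation pair has order `2q`).  Then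
**`hadamard4q_order2q_fpf`: `π^q` and `κ^q` are fixed-point-free**, and **`hadamard4q_order2q_free`: `π^k`, `κ^k` have no fixed
point for `0 < k < 2q`** — the cyclic group of order `2q` acts semiregularly, rows and columns each forming two orbits of length `2q`.
This applies to the three open orders below `1000`: `668 = 4·167`, `716 = 4·179`, `892 = 4·223`.
Proof exactly as for `668` with the general `hadamard4q_fixedRows` (order `q` ⇒ no fixed row/column; Tonchev 1985 §2, kernel gen 9)
in place of `hadamard668_fixedRows_167`: `q ∣ |Fix(π^q)|` (free `⟨π⟩`-action of exponent `q`), pairs of the involution `π^q`, and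
`q` odd give `|Fix(π^q)| ∈ {0, 2q, 4q}`; `4q` means `π^q = 1` hence `κ^q = 1` (`signedAut_snd_eq_one_of_fst_eq_one`, `4q ≡ 4 mod 8`);
`2q` is impossible (`order2q_case2q`: trace lemma + column-pair identity mod 4 when no column is fixed — `2q ≡ 2 (mod 4)` —, or
three moved rows from distinct pairs pairwise orthogonal on the `2q` fixed columns, forcing `4 ∣ 2q`).  The companion file
`Hadamard4qOrder2qNega` adds the sign statement for `q ≡ 3 (mod 4)`.  Ours, not literature (nearest print: Tonchev 1985 for
order `q`; the cocyclic/Ito literature, Horadam 2007 ch. 6, for regular dicyclic actions); no `sorry`.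
-/

namespace Summit.Ventures.DiscreteObjects.Hadamard

open Finset BigOperators Matrix

open Literature.Combinatorics.Designs.GoethalsSeidel (IsHadamardMatrix)

variable {ι : Type*} [Fintype ι] [DecidableEq ι]

section case2q
variable {H : Matrix ι ι ℤ} {π' κ' : Equiv.Perm ι} {d' e' : ι → ℤ} {q : ℕ}

/-- **The case `|Fix(π')| = 2q` is impossible** for a signed involution pair of a Hadamard matrix of order `4q` (`q ≥ 3` odd) whose
fixed columns number `0` or `2q`. -/
theorem order2q_case2q (hH : IsHadamardMatrix H) (hqodd : q % 2 = 1) (hq3 : 3 ≤ q) (hι : Fintype.card ι = 4 * q)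
    (haut : IsSignedAut H π' κ' d' e')
    (hπinv : ∀ i, π' (π' i) = i) (hκinv : ∀ j, κ' (κ' j) = j)
    (hFr : (univ.filter fun i => π' i = i).card = 2 * q)
    (hFc : (univ.filter fun j => κ' j = j).card = 0 ∨ (univ.filter fun j => κ' j = j).card = 2 * q) : False := by
  have hcard : (Fintype.card ι : ℤ) ≠ 0 := by rw [hι]; push_cast; omega
  have hd := haut.1
  have he := haut.2.1
  have hA := haut.2.2
  have eR : (univ.filter fun i => π' i ≠ i) = univ.filter (fun i => ¬ π' i = i) := rfl
  have eC : (univ.filter fun j => κ' j ≠ j) = univ.filter (fun j => ¬ κ' j = j) := rfl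
  have hMr : (univ.filter fun i => ¬ π' i = i).card = 2 * q := by
    have h := Finset.card_filter_add_card_filter_not (s := (univ : Finset ι)) (fun i => π' i = i)
    rw [Finset.card_univ, hι] at h
    omega
  -- a fixed row r₀; the type is ε = +1
  obtain ⟨r₀, hr₀⟩ : (univ.filter fun i => π' i = i).Nonempty := by rw [← Finset.card_pos, hFr]; omega
  have hr₀' : π' r₀ = r₀ := by simpa using hr₀
  have heinv : ∀ j, e' (κ' j) = e' j := by
    intro j
    have h := signedAut_sq_sign hH.1 haut hπinv hκinv r₀ j
    rw [hr₀', pm_mul_self (hd r₀), one_mul] at h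
    exact (pm_eq_of_mul_eq_one (he j) (he (κ' j)) h).symm
  have hdinv : ∀ i, d' (π' i) = d' i := by
    intro i
    have h := signedAut_sq_sign hH.1 haut hπinv hκinv i r₀
    rw [heinv r₀, pm_mul_self (he r₀), mul_one] at h
    exact (pm_eq_of_mul_eq_one (hd i) (hd (π' i)) h).symm
  rcases hFc with hFc0 | hFc2
  · -- |F_c| = 0: trace lemma + column-pair identity + mod 4
    have hFce : (univ.filter fun j => κ' j = j) = ∅ := Finset.card_eq_zero.mp hFc0
    have hSr : ∑ i ∈ univ.filter (fun i => π' i = i), d' i = 0 := by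
      rw [signedAut_trace hH hcard haut, hFce, Finset.sum_empty]
    obtain ⟨j₀⟩ : Nonempty ι := ⟨r₀⟩
    have hj₀ : κ' j₀ ≠ j₀ := by
      intro h
      have : j₀ ∈ univ.filter (fun j => κ' j = j) := by simp [h]
      rw [hFce] at this
      simp at this
    have hcol := signedAut_colPair hH hcard haut hj₀
    rw [← Finset.sum_filter_add_sum_filter_not univ (fun i => π' i = i)] at hcol
    have hfix : ∑ i ∈ univ.filter (fun i => π' i = i), d' i * (H i j₀ * H (π' i) j₀) = 0 := by
      rw [← hSr]
      refine Finset.sum_congr rfl fun i hi => ?_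
      have hi' : π' i = i := by simpa using hi
      rw [hi', pm_mul_self (hH.1 i j₀), mul_one]
    rw [hfix, zero_add] at hcol
    obtain ⟨m, hm⟩ := sum_moved_eq_card_sub_four_mul π' hπinv (fun i => d' i * (H i j₀ * H (π' i) j₀))
      (fun i _ => by
        rcases hd i with h | h <;> rcases hH.1 i j₀ with h1 | h1 <;> rcases hH.1 (π' i) j₀ with h2 | h2 <;>
          simp [h, h1, h2])
      (fun i _ => by
        show d' (π' i) * (H (π' i) j₀ * H (π' (π' i)) j₀) = d' i * (H i j₀ * H (π' i) j₀)
        rw [hdinv i, hπinv i]; ring)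
    rw [eR, hcol, hMr] at hm
    omega
  · -- |F_c| = 2q: all fixed signs equal δ
    have hMc : (univ.filter fun j => ¬ κ' j = j).card = 2 * q := by
      have h := Finset.card_filter_add_card_filter_not (s := (univ : Finset ι)) (fun j => κ' j = j)
      rw [Finset.card_univ, hι] at h
      omega
    have hδ : d' r₀ = 1 ∨ d' r₀ = -1 := hd r₀
    have heδ : ∀ j, κ' j = j → e' j = d' r₀ := fun j hj => (signedAut_fixed_sign hH.1 haut hr₀' hj).symm
    have hterm : ∀ i, π' i ≠ i → ∀ j, κ' j ≠ j → e' j * (H i j * H i (κ' j)) = -d' r₀ := by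
      intro i hi
      have hrow := signedAut_rowPair hH haut hi
      rw [← Finset.sum_filter_add_sum_filter_not univ (fun j => κ' j = j)] at hrow
      have hfix : ∑ j ∈ univ.filter (fun j => κ' j = j), e' j * (H i j * H i (κ' j)) = d' r₀ * (2 * q) := by
        have e1 : ∑ j ∈ univ.filter (fun j => κ' j = j), e' j * (H i j * H i (κ' j))
            = ∑ j ∈ univ.filter (fun j => κ' j = j), d' r₀ := by
          refine Finset.sum_congr rfl fun j hj => ?_
          have hj' : κ' j = j := by simpa using hj
          rw [hj', pm_mul_self (hH.1 i j), mul_one, heδ j hj']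
        rw [e1, Finset.sum_const, hFc2, nsmul_eq_mul, mul_comm]
        push_cast; ring
      rw [hfix] at hrow
      have hsum : ∑ j ∈ univ.filter (fun j => κ' j ≠ j), e' j * (H i j * H i (κ' j))
          = -(d' r₀ * ((univ.filter fun j => κ' j ≠ j).card : ℤ)) := by
        rw [eC, hMc]
        push_cast
        linarith
      have hall := all_eq_neg_of_sum (univ.filter fun j => κ' j ≠ j) (fun j => e' j * (H i j * H i (κ' j))) hδ
        (fun j _ => by
          rcases he j with h | h <;> rcases hH.1 i j with h1 | h1 <;> rcases hH.1 i (κ' j) with h2 | h2 <;>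
            simp [h, h1, h2]) hsum
      intro j hj
      exact hall j (by simpa using hj)
    have hrowfix : ∀ i j, κ' j = j → H (π' i) j = d' r₀ * d' i * H i j := by
      intro i j hj
      have h := hA i j
      rw [hj] at h
      rw [h, heδ j hj]
      ring
    have hrowmov : ∀ i, π' i ≠ i → ∀ j, κ' j ≠ j → H (π' i) j = -(d' r₀ * d' i * H i j) := by
      intro i hi j hj
      have hj2 : κ' (κ' j) ≠ κ' j := by rw [hκinv j]; exact Ne.symm hj
      have ht := hterm i hi (κ' j) hj2
      rw [hκinv j, heinv j] at ht
      have h := hA i (κ' j)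
      rw [hκinv j, heinv j] at h
      have hsq := pm_mul_self (hH.1 i j)
      have h3 : e' j * H i (κ' j) = -d' r₀ * H i j := by
        calc e' j * H i (κ' j) = e' j * (H i (κ' j) * H i j) * H i j := by
              rw [mul_assoc, mul_assoc, hsq, mul_one]
          _ = -d' r₀ * H i j := by rw [ht]
      rw [h]
      calc d' i * e' j * H i (κ' j) = d' i * (e' j * H i (κ' j)) := by ring
        _ = d' i * (-d' r₀ * H i j) := by rw [h3]
        _ = -(d' r₀ * d' i * H i j) := by ring
    have horth : ∀ i k, π' i ≠ i → k ≠ i → k ≠ π' i →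
        ∑ j ∈ univ.filter (fun j => κ' j = j), H i j * H k j = 0 := by
      intro i k hi hki hkπ
      have o1 := hadamard_row_orth H hH (Ne.symm hki)
      have o2 := hadamard_row_orth H hH (Ne.symm hkπ)
      rw [← Finset.sum_filter_add_sum_filter_not univ (fun j => κ' j = j)] at o1 o2
      have s1 : ∑ j ∈ univ.filter (fun j => κ' j = j), H (π' i) j * H k j
          = d' r₀ * d' i * ∑ j ∈ univ.filter (fun j => κ' j = j), H i j * H k j := by
        rw [Finset.mul_sum]
        refine Finset.sum_congr rfl fun j hj => ?_
        rw [hrowfix i j (by simpa using hj)]; ring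
      have s2 : ∑ j ∈ univ.filter (fun j => ¬ κ' j = j), H (π' i) j * H k j
          = -(d' r₀ * d' i) * ∑ j ∈ univ.filter (fun j => ¬ κ' j = j), H i j * H k j := by
        rw [Finset.mul_sum]
        refine Finset.sum_congr rfl fun j hj => ?_
        rw [hrowmov i hi j (by simpa using hj)]; ring
      rw [s1, s2] at o2
      have hδd : d' r₀ * d' i = 1 ∨ d' r₀ * d' i = -1 := by
        rcases hδ with h | h <;> rcases hd i with h' | h' <;> simp [h, h']
      rcases hδd with h | h <;> rw [h] at o2 <;> linarith
    obtain ⟨i₁, hi₁⟩ : (univ.filter fun i => ¬ π' i = i).Nonempty := by rw [← Finset.card_pos, hMr]; omega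
    have hi₁' : π' i₁ ≠ i₁ := by simpa using hi₁
    obtain ⟨i₂, hi₂⟩ : (((univ.filter fun i => ¬ π' i = i).erase i₁).erase (π' i₁)).Nonempty := by
      rw [← Finset.card_pos]
      have h1 := Finset.pred_card_le_card_erase (s := univ.filter fun i => ¬ π' i = i) (a := i₁)
      have h2 := Finset.pred_card_le_card_erase (s := (univ.filter fun i => ¬ π' i = i).erase i₁) (a := π' i₁)
      omega
    simp only [Finset.mem_erase] at hi₂
    obtain ⟨h2π1, h21, hi₂M⟩ := hi₂
    have hi₂' : π' i₂ ≠ i₂ := by simpa using hi₂M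
    obtain ⟨i₃, hi₃⟩ :
        (((((univ.filter fun i => ¬ π' i = i).erase i₁).erase (π' i₁)).erase i₂).erase (π' i₂)).Nonempty := by
      rw [← Finset.card_pos]
      have h1 := Finset.pred_card_le_card_erase (s := univ.filter fun i => ¬ π' i = i) (a := i₁)
      have h2 := Finset.pred_card_le_card_erase (s := (univ.filter fun i => ¬ π' i = i).erase i₁) (a := π' i₁)
      have h3 := Finset.pred_card_le_card_erase
        (s := ((univ.filter fun i => ¬ π' i = i).erase i₁).erase (π' i₁)) (a := i₂)
      have h4 := Finset.pred_card_le_card_erase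
        (s := (((univ.filter fun i => ¬ π' i = i).erase i₁).erase (π' i₁)).erase i₂) (a := π' i₂)
      omega
    simp only [Finset.mem_erase] at hi₃
    obtain ⟨h3π2, h32, h3π1, h31, hi₃M⟩ := hi₃
    have key := card_eq_four_mul_of_three_orth (univ.filter fun j => κ' j = j)
      (fun j => H i₁ j) (fun j => H i₂ j) (fun j => H i₃ j)
      (fun j _ => hH.1 i₁ j) (fun j _ => hH.1 i₂ j) (fun j _ => hH.1 i₃ j)
      (horth i₁ i₂ hi₁' h21 h2π1) (horth i₁ i₃ hi₁' h31 h3π1) (horth i₂ i₃ hi₂' h32 h3π2)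
    rw [hFc2] at key
    omega

end case2q

section main
variable {H : Matrix ι ι ℤ} {π κ : Equiv.Perm ι} {d e : ι → ℤ} {q : ℕ}

/-- the fixed rows of `π^q` number `0` or `2q`, or `π^q = 1`; `π²` is fixed-point-free; `π^q` is an involution -/
lemma order2q_card_fixed (hH : IsHadamardMatrix H) (hq : q.Prime) (hq5 : 5 ≤ q) (hι : Fintype.card ι = 4 * q)
    (haut : IsSignedAut H π κ d e) (hπ : π ^ (2 * q) = 1) (hκ : κ ^ (2 * q) = 1) (h2 : π ^ 2 ≠ 1 ∨ κ ^ 2 ≠ 1) :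
    ((univ.filter fun i => (π ^ q) i = i).card = 0 ∨ (univ.filter fun i => (π ^ q) i = i).card = 2 * q ∨ π ^ q = 1) ∧
    (∀ i, (π ^ 2) i ≠ i) ∧ (∀ i, (π ^ q) ((π ^ q) i) = i) := by
  have hqodd : q % 2 = 1 := Nat.odd_iff.mp (hq.odd_of_ne_two (by omega))
  have hfix := hadamard4q_fixedRows hH q hq hq5 hι (π ^ 2) (κ ^ 2) _ _ (isSignedAut_pow haut 2)
    (by rw [← pow_mul]; exact hπ) (by rw [← pow_mul]; exact hκ) h2
  have hπ2 : ∀ i, (π ^ 2) i ≠ i := by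
    intro i hi
    have hmem : i ∈ univ.filter (fun i => (π ^ 2) i = i) := by simp [hi]
    rw [Finset.card_eq_zero.mp hfix.1] at hmem
    simp at hmem
  have hinv : ∀ i, (π ^ q) ((π ^ q) i) = i := by
    intro i
    rw [← Equiv.Perm.mul_apply, ← pow_add, ← two_mul, hπ, Equiv.Perm.one_apply]
  refine ⟨?_, hπ2, hinv⟩
  have hsplit := Finset.card_filter_add_card_filter_not (s := (univ : Finset ι)) (fun i => (π ^ q) i = i)
  rw [Finset.card_univ, hι] at hsplit
  have h2dvd := two_dvd_card_moved (π ^ q) hinv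
  have e1 : (univ.filter fun i => (π ^ q) i ≠ i) = univ.filter (fun i => ¬ (π ^ q) i = i) := rfl
  rw [e1] at h2dvd
  have hqdvd := dvd_card_fixed_pow π hq
    (fun i _ hπi => hπ2 i (by rw [pow_two, Equiv.Perm.mul_apply, hπi, hπi]))
  obtain ⟨a, ha⟩ := hqdvd
  obtain ⟨b, hb⟩ := h2dvd
  have ha4 : a ≤ 4 := by
    have : q * a ≤ q * 4 := by rw [← ha]; omega
    exact Nat.le_of_mul_le_mul_left this hq.pos
  interval_cases a
  · left; rw [ha, mul_zero]
  · exfalso; omega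
  · right; left; rw [ha]; ring
  · exfalso; omega
  · right; right
    have huniv : (univ.filter fun i => (π ^ q) i = i) = univ :=
      Finset.eq_univ_of_card _ (by rw [ha, hι]; ring)
    ext i
    have : i ∈ univ.filter (fun i => (π ^ q) i = i) := by rw [huniv]; exact Finset.mem_univ i
    simpa using this

/-- **Order 2q, rows: `π^q` is fixed-point-free.** -/
theorem hadamard4q_order2q_rows_fpf (hH : IsHadamardMatrix H) (hq : q.Prime) (hq5 : 5 ≤ q) (hι : Fintype.card ι = 4 * q)
    (haut : IsSignedAut H π κ d e)
    (hπ : π ^ (2 * q) = 1) (hκ : κ ^ (2 * q) = 1) (h2 : π ^ 2 ≠ 1 ∨ κ ^ 2 ≠ 1) (hq1 : π ^ q ≠ 1 ∨ κ ^ q ≠ 1) :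
    ∀ i, (π ^ q) i ≠ i := by
  have hqodd : q % 2 = 1 := Nat.odd_iff.mp (hq.odd_of_ne_two (by omega))
  have hcard : (Fintype.card ι : ℤ) ≠ 0 := by rw [hι]; push_cast; omega
  have hmod : Fintype.card ι % 8 = 4 := by rw [hι]; omega
  have hne4 : Fintype.card ι ≠ 4 := by rw [hι]; omega
  have haut' : IsSignedAut H (π ^ q) (κ ^ q) (fun i => cyc π d i q) (fun j => cyc κ e j q) := isSignedAut_pow haut q
  obtain ⟨hr, hπ2, hπinv⟩ := order2q_card_fixed hH hq hq5 hι haut hπ hκ h2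
  obtain ⟨hc, hκ2, hκinv⟩ := order2q_card_fixed (isHadamard_transpose hH hcard) hq hq5 hι (isSignedAut_transpose haut) hκ hπ
    h2.symm
  have hπ1 : π ^ q ≠ 1 := by
    intro h1
    rw [h1] at haut'
    have := signedAut_snd_eq_one_of_fst_eq_one hH hmod hne4 haut'
    rcases hq1 with h | h
    · exact h h1
    · exact h this
  have hκ1 : κ ^ q ≠ 1 := by
    intro h1
    rw [h1] at haut'
    exact hπ1 (signedAut_fst_eq_one_of_snd_eq_one hH hmod hne4 haut')
  rcases hr with hr0 | hr2 | hr4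
  · intro i hi
    have hmem : i ∈ univ.filter (fun i => (π ^ q) i = i) := by simp [hi]
    rw [Finset.card_eq_zero.mp hr0] at hmem
    simp at hmem
  · exfalso
    rcases hc with hc0 | hc2 | hc4
    · exact order2q_case2q hH hqodd (by omega) hι haut' hπinv hκinv hr2 (Or.inl hc0)
    · exact order2q_case2q hH hqodd (by omega) hι haut' hπinv hκinv hr2 (Or.inr hc2)
    · exact hκ1 hc4
  · exact absurd hr4 hπ1

/-- **Order 2q in a Hadamard matrix of order 4q (q ≥ 5 prime): `π^q` and `κ^q` are fixed-point-free.** -/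
theorem hadamard4q_order2q_fpf (hH : IsHadamardMatrix H) (q : ℕ) (hq : q.Prime) (hq5 : 5 ≤ q) (hι : Fintype.card ι = 4 * q)
    (π κ : Equiv.Perm ι) (d e : ι → ℤ) (haut : IsSignedAut H π κ d e)
    (hπ : π ^ (2 * q) = 1) (hκ : κ ^ (2 * q) = 1) (h2 : π ^ 2 ≠ 1 ∨ κ ^ 2 ≠ 1) (hq1 : π ^ q ≠ 1 ∨ κ ^ q ≠ 1) :
    (∀ i, (π ^ q) i ≠ i) ∧ (∀ j, (κ ^ q) j ≠ j) := by
  have hqodd : q % 2 = 1 := Nat.odd_iff.mp (hq.odd_of_ne_two (by omega))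
  have hcard : (Fintype.card ι : ℤ) ≠ 0 := by rw [hι]; push_cast; omega
  exact ⟨hadamard4q_order2q_rows_fpf hH hq hq5 hι haut hπ hκ h2 hq1,
    hadamard4q_order2q_rows_fpf (isHadamard_transpose hH hcard) hq hq5 hι (isSignedAut_transpose haut) hκ hπ h2.symm hq1.symm⟩

/-- **Order 2q is semiregular**: `π^k` and `κ^k` have no fixed point for `0 < k < 2q` — rows and columns each form two orbits of
length `2q`. -/
theorem hadamard4q_order2q_free (hH : IsHadamardMatrix H) (q : ℕ) (hq : q.Prime) (hq5 : 5 ≤ q) (hι : Fintype.card ι = 4 * q)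
    (π κ : Equiv.Perm ι) (d e : ι → ℤ) (haut : IsSignedAut H π κ d e)
    (hπ : π ^ (2 * q) = 1) (hκ : κ ^ (2 * q) = 1) (h2 : π ^ 2 ≠ 1 ∨ κ ^ 2 ≠ 1) (hq1 : π ^ q ≠ 1 ∨ κ ^ q ≠ 1) :
    (∀ i k, 0 < k → k < 2 * q → (π ^ k) i ≠ i) ∧ (∀ j k, 0 < k → k < 2 * q → (κ ^ k) j ≠ j) := by
  have hqodd : q % 2 = 1 := Nat.odd_iff.mp (hq.odd_of_ne_two (by omega))
  have hcard : (Fintype.card ι : ℤ) ≠ 0 := by rw [hι]; push_cast; omega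
  obtain ⟨hr, hc⟩ := hadamard4q_order2q_fpf hH q hq hq5 hι π κ d e haut hπ hκ h2 hq1
  obtain ⟨-, hπ2, -⟩ := order2q_card_fixed hH hq hq5 hι haut hπ hκ h2
  obtain ⟨-, hκ2, -⟩ := order2q_card_fixed (isHadamard_transpose hH hcard) hq hq5 hι (isSignedAut_transpose haut) hκ hπ h2.symm
  have key : ∀ (σ : Equiv.Perm ι), σ ^ (2 * q) = 1 → (∀ i, (σ ^ q) i ≠ i) → (∀ i, (σ ^ 2) i ≠ i) →
      ∀ i k, 0 < k → k < 2 * q → (σ ^ k) i ≠ i := by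
    intro σ hσ hq' h2' i k hk0 hk hfix
    by_cases hdvd : q ∣ k
    · obtain ⟨t, rfl⟩ := hdvd
      have ht : t < 2 := Nat.lt_of_mul_lt_mul_left (by rw [mul_comm 2 q] at hk; exact hk)
      have ht1 : t = 1 := by
        rcases Nat.eq_zero_or_pos t with h | h
        · subst h; simp at hk0
        · omega
      subst ht1
      exact hq' i (by simpa using hfix)
    · have hcop : Nat.Coprime k q := (Nat.Prime.coprime_iff_not_dvd hq).mpr hdvd |>.symm
      have h1 : ((σ ^ 2) ^ k) i = i := by
        rw [← pow_mul, mul_comm, pow_mul]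
        exact perm_pow_apply_of_fixed _ hfix 2
      have h2'' : ((σ ^ 2) ^ q) i = i := by
        rw [← pow_mul, hσ, Equiv.Perm.one_apply]
      exact h2' i (perm_fixed_of_pow_coprime (σ ^ 2) hcop hq.one_lt h1 h2'')
  exact ⟨key π hπ hr hπ2, key κ hκ hc hκ2⟩

end main

end Summit.Ventures.DiscreteObjects.Hadamard
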